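import Mathlib
import HarnessLib
import Summits.HubbardSuperconductivity.HubbardSuperconductivity.Theorems.BirComplexStableXY.Negative.WitnessTable

/-!
# Crux `BirComplexStableXYR` (stmt-HubbardSuperconductivity-14845), line log-concave-core-bounded-phase:
# tree-gauge recentring of a window ("local gauge")

Support file (stub `stub_localGauge` of the line skeleton).  On the space-time torus
`Λ = TorusSite 2 L × ZMod M` the window at `s` has sites `p(w) = (s.1 + ![w.1, w.2.1], s.2 + w.2.2)`,
`w ∈ Fin r × Fin r × Fin r`, the unit steps are `e₀ = (![1,0],0)`, `e₁ = (![0,1],0)`, `e₂ = (0,1)`, and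
an integer bond field `nb` defines the LIFTED gradient `θ(p + eᵢ) − θ(p) − 2π·nb(p,i)`.  If every bond
staying inside the window has lifted gradient at most `δ` in absolute value, then the integer
recentring

  `m(a,b,t) = Σ_{j<a} nb(p(j,0,0),0) + Σ_{j<b} nb(p(a,j,0),1) + Σ_{j<t} nb(p(a,b,j),2)`

(bond integers accumulated along the coordinate path `0 → (a,0,0) → (a,b,0) → (a,b,t)`) makes the
recentred configuration `θ(p w) − 2π·m(w)` oscillate by at most `6(r−1)δ` on the window
(`lccb_localGauge`): `θ(p w) − 2π·m(w) − θ(p 0)` telescopes into at most `3(r−1)` lifted gradients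
(`lccb_telescope`, `lccb_treeGauge`), and two window sites are compared through the corner.  This is
the "lifted-small ⇒ small after an integer recentring" half of the core dichotomy of the line.
Pure finite combinatorics and the triangle inequality. [folklore]
-/

noncomputable section

namespace Summit.HubbardSuperconductivity.HubbardSuperconductivity.Theorems

open scoped BigOperators
open Literature.Probability.LatticeModels

/-- One-dimensional telescoping along a coordinate segment: if each lifted step
`f(j+1) − f(j) − 2π·n(j)`, `j < a`, is at most `δ` in absolute value, then
`|f(a) − 2π·Σ_{j<a} n(j) − f(0)| ≤ a·δ`. [folklore] -/
theorem lccb_telescope (f : ℕ → ℝ) (n : ℕ → ℤ) (δ : ℝ) :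
    ∀ a : ℕ, (∀ j, j < a → |f (j + 1) - f j - 2 * Real.pi * (n j : ℝ)| ≤ δ) →
      |f a - 2 * Real.pi * ((∑ j ∈ Finset.range a, n j : ℤ) : ℝ) - f 0| ≤ (a : ℝ) * δ := by
  intro a
  induction a with
  | zero =>
    intro _
    simp
  | succ a ih =>
    intro h
    have ih' := ih (fun j hj => h j (by omega))
    have ha := h a (by omega)
    have e : f (a + 1) - 2 * Real.pi * ((∑ j ∈ Finset.range (a + 1), n j : ℤ) : ℝ) - f 0 =
        (f (a + 1) - f a - 2 * Real.pi * (n a : ℝ)) +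
          (f a - 2 * Real.pi * ((∑ j ∈ Finset.range a, n j : ℤ) : ℝ) - f 0) := by
      rw [Finset.sum_range_succ, Int.cast_add]
      ring
    rw [e]
    calc _ ≤ _ + _ := abs_add_le _ _
      _ ≤ δ + (a : ℝ) * δ := add_le_add ha ih'
      _ = ((a + 1 : ℕ) : ℝ) * δ := by push_cast; ring

/-- Abstract tree-gauge recentring on the discrete cube `{0,…,r−1}³`: if the lifted unit steps of
`F` (with bond integers `n · · · i` in the three coordinate directions `i = 0, 1, 2`) that stay inside
the cube are at most `δ ≥ 0` in absolute value, then the recentring by the bond integers accumulated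
along the coordinate path `0 → (a,0,0) → (a,b,0) → (a,b,t)` has pairwise differences at most
`6(r−1)δ`. [folklore] -/
theorem lccb_treeGauge (r : ℕ) (F : ℕ → ℕ → ℕ → ℝ) (n : ℕ → ℕ → ℕ → Fin 3 → ℤ) (δ : ℝ)
    (hδ : 0 ≤ δ)
    (h0 : ∀ a b t : ℕ, a + 1 < r → b < r → t < r →
      |F (a + 1) b t - F a b t - 2 * Real.pi * (n a b t 0 : ℝ)| ≤ δ)
    (h1 : ∀ a b t : ℕ, a < r → b + 1 < r → t < r →
      |F a (b + 1) t - F a b t - 2 * Real.pi * (n a b t 1 : ℝ)| ≤ δ)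
    (h2 : ∀ a b t : ℕ, a < r → b < r → t + 1 < r →
      |F a b (t + 1) - F a b t - 2 * Real.pi * (n a b t 2 : ℝ)| ≤ δ) :
    ∃ m : (Fin r × Fin r × Fin r) → ℤ, ∀ w w' : Fin r × Fin r × Fin r,
      |(F w.1 w.2.1 w.2.2 - 2 * Real.pi * (m w : ℝ)) -
          (F w'.1 w'.2.1 w'.2.2 - 2 * Real.pi * (m w' : ℝ))| ≤ 6 * ((r : ℝ) - 1) * δ := by
  -- one-point bound against the corner value `F 0 0 0`
  have key : ∀ a b t : ℕ, a < r → b < r → t < r →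
      |(F a b t - 2 * Real.pi *
          (((∑ j ∈ Finset.range a, n j 0 0 0) + (∑ j ∈ Finset.range b, n a j 0 1) +
              (∑ j ∈ Finset.range t, n a b j 2) : ℤ) : ℝ)) - F 0 0 0| ≤
        3 * ((r : ℝ) - 1) * δ := by
    intro a b t ha hb ht
    have ea := lccb_telescope (fun j => F j 0 0) (fun j => n j 0 0 0) δ a
      (fun j hj => h0 j 0 0 (by omega) (by omega) (by omega))
    have eb := lccb_telescope (fun j => F a j 0) (fun j => n a j 0 1) δ b
      (fun j hj => h1 a j 0 ha (by omega) (by omega))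
    have et := lccb_telescope (fun j => F a b j) (fun j => n a b j 2) δ t
      (fun j hj => h2 a b j ha hb (by omega))
    have ha' : (a : ℝ) ≤ (r : ℝ) - 1 := by
      have : (a : ℝ) + 1 ≤ r := by exact_mod_cast ha
      linarith
    have hb' : (b : ℝ) ≤ (r : ℝ) - 1 := by
      have : (b : ℝ) + 1 ≤ r := by exact_mod_cast hb
      linarith
    have ht' : (t : ℝ) ≤ (r : ℝ) - 1 := by
      have : (t : ℝ) + 1 ≤ r := by exact_mod_cast ht
      linarith
    have e : (F a b t - 2 * Real.pi *
          (((∑ j ∈ Finset.range a, n j 0 0 0) + (∑ j ∈ Finset.range b, n a j 0 1) +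
              (∑ j ∈ Finset.range t, n a b j 2) : ℤ) : ℝ)) - F 0 0 0 =
        (F a b t - 2 * Real.pi * ((∑ j ∈ Finset.range t, n a b j 2 : ℤ) : ℝ) - F a b 0) +
        (F a b 0 - 2 * Real.pi * ((∑ j ∈ Finset.range b, n a j 0 1 : ℤ) : ℝ) - F a 0 0) +
        (F a 0 0 - 2 * Real.pi * ((∑ j ∈ Finset.range a, n j 0 0 0 : ℤ) : ℝ) - F 0 0 0) := by
      push_cast
      ring
    rw [e]
    calc _ ≤ _ + _ + _ := abs_add_three _ _ _
      _ ≤ (t : ℝ) * δ + (b : ℝ) * δ + (a : ℝ) * δ := add_le_add (add_le_add et eb) ea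
      _ ≤ ((r : ℝ) - 1) * δ + ((r : ℝ) - 1) * δ + ((r : ℝ) - 1) * δ :=
        add_le_add (add_le_add (mul_le_mul_of_nonneg_right ht' hδ)
          (mul_le_mul_of_nonneg_right hb' hδ)) (mul_le_mul_of_nonneg_right ha' hδ)
      _ = 3 * ((r : ℝ) - 1) * δ := by ring
  -- the recentring integers along the coordinate path, and comparison through the corner
  refine ⟨fun w => (∑ j ∈ Finset.range (w.1 : ℕ), n j 0 0 0) +
      (∑ j ∈ Finset.range (w.2.1 : ℕ), n w.1 j 0 1) +
      (∑ j ∈ Finset.range (w.2.2 : ℕ), n w.1 w.2.1 j 2), ?_⟩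
  intro w w'
  have hw := key w.1 w.2.1 w.2.2 w.1.isLt w.2.1.isLt w.2.2.isLt
  have hw' := key w'.1 w'.2.1 w'.2.2 w'.1.isLt w'.2.1.isLt w'.2.2.isLt
  rw [abs_sub_comm] at hw'
  calc _ ≤ _ + _ := abs_sub_le _ (F 0 0 0) _
    _ ≤ 3 * ((r : ℝ) - 1) * δ + 3 * ((r : ℝ) - 1) * δ := add_le_add hw hw'
    _ = 6 * ((r : ℝ) - 1) * δ := by ring

/-- **Local gauge (tree-gauge recentring of a window).**  On `Λ = TorusSite 2 L × ZMod M`, if every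
unit-step bond staying inside the window `{sh s w : w ∈ Fin r³}` has lifted gradient
`|θ(p + eᵢ) − θ(p) − 2π·nb(p,i)| ≤ δ`, then there is an integer recentring `m` of the window with
recentred oscillation `|(θ(p w) − 2π m w) − (θ(p w') − 2π m w')| ≤ 6(r−1)δ`. [folklore] -/
theorem lccb_localGauge :
    ∀ (r L M : ℕ) [NeZero L] [NeZero M], r ≤ L → r ≤ M →
    ∀ (θ : (Literature.Probability.LatticeModels.TorusSite 2 L × ZMod M) → ℝ)
      (nb : ((Literature.Probability.LatticeModels.TorusSite 2 L × ZMod M) × Fin 3) → ℤ)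
      (s : Literature.Probability.LatticeModels.TorusSite 2 L × ZMod M) (δ : ℝ), 0 ≤ δ →
    (∀ (w : Fin r × Fin r × Fin r) (i : Fin 3),
      (![(w.1 : ℕ), (w.2.1 : ℕ), (w.2.2 : ℕ)] i) + 1 < r →
      |θ ((s.1 + ![((w.1 : ℕ) : ZMod L), ((w.2.1 : ℕ) : ZMod L)], s.2 + ((w.2.2 : ℕ) : ZMod M)) +
            (![((![1, 0] : Literature.Probability.LatticeModels.TorusSite 2 L), (0 : ZMod M)), (![0, 1], 0), (0, 1)] :
              Fin 3 → Literature.Probability.LatticeModels.TorusSite 2 L × ZMod M) i)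
        - θ (s.1 + ![((w.1 : ℕ) : ZMod L), ((w.2.1 : ℕ) : ZMod L)], s.2 + ((w.2.2 : ℕ) : ZMod M))
        - 2 * Real.pi * (nb ((s.1 + ![((w.1 : ℕ) : ZMod L), ((w.2.1 : ℕ) : ZMod L)], s.2 + ((w.2.2 : ℕ) : ZMod M)), i))| ≤ δ) →
    ∃ m : (Fin r × Fin r × Fin r) → ℤ, ∀ w w' : Fin r × Fin r × Fin r,
      |(θ (s.1 + ![((w.1 : ℕ) : ZMod L), ((w.2.1 : ℕ) : ZMod L)], s.2 + ((w.2.2 : ℕ) : ZMod M)) - 2 * Real.pi * (m w)) -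
        (θ (s.1 + ![((w'.1 : ℕ) : ZMod L), ((w'.2.1 : ℕ) : ZMod L)], s.2 + ((w'.2.2 : ℕ) : ZMod M)) - 2 * Real.pi * (m w'))|
        ≤ 6 * ((r : ℝ) - 1) * δ := by
  intro r L M _ _ _ _ θ nb s δ hδ H
  refine lccb_treeGauge r
    (fun a b t => θ (s.1 + ![((a : ℕ) : ZMod L), ((b : ℕ) : ZMod L)], s.2 + ((t : ℕ) : ZMod M)))
    (fun a b t i => nb ((s.1 + ![((a : ℕ) : ZMod L), ((b : ℕ) : ZMod L)], s.2 + ((t : ℕ) : ZMod M)), i))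
    δ hδ ?_ ?_ ?_
  · intro a b t ha hb ht
    have h := H (⟨a, by omega⟩, ⟨b, hb⟩, ⟨t, ht⟩) 0 (by simpa using ha)
    simpa [add_assoc, Nat.cast_succ] using h
  · intro a b t ha hb ht
    have h := H (⟨a, ha⟩, ⟨b, by omega⟩, ⟨t, ht⟩) 1 (by simpa using hb)
    simpa [add_assoc, Nat.cast_succ] using h
  · intro a b t ha hb ht
    have h := H (⟨a, ha⟩, ⟨b, hb⟩, ⟨t, by omega⟩) 2 (by simpa using ht)
    simpa [add_assoc, Nat.cast_succ] using h

end Summit.HubbardSuperconductivity.HubbardSuperconductivity.Theorems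

end
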